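import Summits.ValiantsHypothesis.ValiantsHypothesis.Theorems.SymPencilPerFourPeeledCornerSwap

/-!
# Route `SymPencil` — `2 | 2` inner rank of `per_4`, PEELED case at `≤ 11` squares: the
# DOUBLE-SWAP CORNER on the same pair is EMPTY (`--supports` stmt-ValiantsHypothesis-5674
# `SdcSuperquadratic`; (8,8) column, cell (8,8,11); memo `NOTE-p6g16-5674-corner-double-swap.md`
# §2–§3; rung currency only)

**Theorem** (`false_of_double_swap_same_pair`).  There is no reduced peeled family on `≤ 11`
squares (non-zero weights) whose two corrections are pure swaps on the same pair of coordinates,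
`ψ(a,x) = u₀(a₀x₁ + a₁x₀)`, `ψ'(b,x) = u₁(b₀x₁ + b₁x₀)`.  Proof (memo §2): the eleven vectors
`μ₁₁, μ₀₀, μ₀₁, μ₁₀, μ₂₃, μ₁₃, μ₀₃, μ₁₂, μ₀₂, v₀, v₀'` are linearly independent (triangular pairing
pattern against `ν₀₀, ν₁₁, ν₀₂, ν₁₂, ν₀₃, ν₁₃, ν₂₃, ν₀₁, ν₁₀, v₀', v₀`, the `3 × 3` block having
determinant `∝ u₀u₁λ`), hence span `K^κ` (`|κ| ≤ 11`); every left-kernel combination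
`ν₂₀ − ν₀₂, ν₂₁ − ν₁₂, ν₃₁ − ν₁₃, ν₃₂ − ν₂₃` is orthogonal to all of them, hence zero — these are
the relations of `…CornerSwap.false_of_swap_of_relations`, which finishes (memo §3).  Other pairs
for `ψ'` and the coordinate-permuted corners are NOT treated here (memo §1, `transport_perm`).

Honest framing: ONE corner of the (8,8,11) case analysis in the kernel; no cell closes;
`28 ≤ sdc(per_4) ≤ 29`, the crux `SdcSuperquadratic` and `VP ≠ VNP` are untouched.  The Gram
bookkeeping block is again val-lit-p8 g15's (`…TwoPencilDesign`).  No definitions, no named facts.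
[folklore]
-/

noncomputable section

-- single-conjunct layout: Sub = Summit, duplicated namespace component intended
set_option linter.dupNamespace false

namespace Summit.ValiantsHypothesis.ValiantsHypothesis.Theorems.SymPencilPerFourPeeledCornerSwapSamePair

open Matrix Finset Module
open Summit.ValiantsHypothesis.ValiantsHypothesis.Theorems.SymPencilPerFourInnerRankRows
open Summit.ValiantsHypothesis.ValiantsHypothesis.Theorems.SymPencilPerFourInnerRankTenPairs
open Summit.ValiantsHypothesis.ValiantsHypothesis.Theorems.SymPencilPerFourInnerRankScalarBlock
open Summit.ValiantsHypothesis.ValiantsHypothesis.Theorems.SymPencilPerFourInnerRankReducedFamily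
open Summit.ValiantsHypothesis.ValiantsHypothesis.Theorems.SymPencilPerFourPeeledFrame
open Summit.ValiantsHypothesis.ValiantsHypothesis.Theorems.SymPencilPerFourPeeledTwoPencilDesign
open Summit.ValiantsHypothesis.ValiantsHypothesis.Theorems.SymPencilPerFourPeeledTenCaseA
open Summit.ValiantsHypothesis.ValiantsHypothesis.Theorems.SymPencilPerFourPeeledCornerSwap

universe u v

variable {K : Type u} [Field K]

/-- **Orthogonal to a spanning family ⇒ zero** (weights `c_r ≠ 0`). [folklore] -/
theorem eq_zero_of_orth_span {κ : Type v} [Fintype κ] [DecidableEq κ] {ι : Type*}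
    (c : κ → K) (hc : ∀ r, c r ≠ 0) (m : ι → κ → K)
    (hspan : Submodule.span K (Set.range m) = ⊤) (n : κ → K)
    (horth : ∀ j, ∑ r, c r * n r * m j r = 0) : n = 0 := by
  classical
  let φ : (κ → K) →ₗ[K] K :=
    { toFun := fun x => ∑ r, c r * n r * x r
      map_add' := fun x x' => by
        simp only [Pi.add_apply, mul_add, Finset.sum_add_distrib]
      map_smul' := fun s x => by
        simp only [Pi.smul_apply, smul_eq_mul, RingHom.id_apply, Finset.mul_sum]
        exact Finset.sum_congr rfl fun r _ => by ring }
  have hφ : φ = 0 := LinearMap.ext_on_range hspan fun j => by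
    rw [LinearMap.zero_apply]; exact horth j
  funext r
  have h := congrArg (fun f : (κ → K) →ₗ[K] K => f (Pi.single r 1)) hφ
  simp only [φ, LinearMap.coe_mk, AddHom.coe_mk, LinearMap.zero_apply, Pi.single_apply, mul_ite,
    mul_one, mul_zero, Finset.sum_ite_eq', Finset.mem_univ, if_true] at h
  exact (mul_eq_zero.1 h).resolve_left (hc r)

/-- **Eleven independent vectors** (memo §2b): `μ₁₁, μ₀₀, μ₀₁, μ₁₀, μ₂₃, μ₁₃, μ₀₃, μ₁₂, μ₀₂, v₀,
v₀'`, by the triangular pairing pattern against `ν₀₀, ν₁₁, ν₀₂, ν₁₂, ν₀₃, ν₁₃, ν₂₃, ν₀₁, ν₁₀, v₀', v₀`.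
[folklore] -/
theorem linearIndependent_eleven [CharZero K] {κ : Type v} [Fintype κ] [DecidableEq κ]
    (c : κ → K) (N M : Fin 4 → Fin 4 → κ → K) (v₀ v₀' : κ → K) (ρ : K)
    (hNMf : ∀ a b y z : Fin 4, ∑ r, c r * N b y r * M a z r =
      (if (a ≠ b ∧ a ≠ y ∧ a ≠ z ∧ b ≠ y ∧ b ≠ z ∧ y ≠ z) then (1 / 2 : K) else 0) -
      ρ * ((Pi.single a 1 : Fin 4 → K) 0 * (Pi.single y 1 : Fin 4 → K) 1 +
        (Pi.single a 1 : Fin 4 → K) 1 * (Pi.single y 1 : Fin 4 → K) 0) *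
      ((Pi.single b 1 : Fin 4 → K) 0 * (Pi.single z 1 : Fin 4 → K) 1 +
        (Pi.single b 1 : Fin 4 → K) 1 * (Pi.single z 1 : Fin 4 → K) 0) *
      ∑ r, c r * v₀ r * v₀' r)
    (hNv0 : ∀ b y : Fin 4, ∑ r, c r * N b y r * v₀ r = 0)
    (hNv0' : ∀ b y : Fin 4, ∑ r, c r * N b y r * v₀' r = 0)
    (hv0M : ∀ a z : Fin 4, ∑ r, c r * v₀ r * M a z r = 0)
    (hv0'M : ∀ a z : Fin 4, ∑ r, c r * v₀' r * M a z r = 0)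
    (hv0v0 : ∑ r, c r * v₀ r * v₀ r = 0) (hv0'v0' : ∑ r, c r * v₀' r * v₀' r = 0)
    (hρ : ρ ≠ 0) (hlam : ∑ r, c r * v₀ r * v₀' r ≠ 0) :
    LinearIndependent K (![M 1 1, M 0 0, M 0 1, M 1 0, M 2 3, M 1 3, M 0 3, M 1 2, M 0 2, v₀, v₀'] : Fin 11 → κ → K) := by
  classical
  have hv0'v0 : ∑ r, c r * v₀' r * v₀ r = ∑ r, c r * v₀ r * v₀' r := wdot_comm _ _ _
  rw [Fintype.linearIndependent_iff]
  intro g hg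
  have key : ∀ τ : κ → K, ∑ j, g j * ∑ r, c r * τ r * (![M 1 1, M 0 0, M 0 1, M 1 0, M 2 3, M 1 3, M 0 3, M 1 2, M 0 2, v₀, v₀'] : Fin 11 → κ → K) j r = 0 := by
    intro τ
    have e : ∑ j, g j * ∑ r, c r * τ r * (![M 1 1, M 0 0, M 0 1, M 1 0, M 2 3, M 1 3, M 0 3, M 1 2, M 0 2, v₀, v₀'] : Fin 11 → κ → K) j r =
        ∑ r, c r * τ r * (∑ j, g j • (![M 1 1, M 0 0, M 0 1, M 1 0, M 2 3, M 1 3, M 0 3, M 1 2, M 0 2, v₀, v₀'] : Fin 11 → κ → K) j) r := by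
      simp only [Finset.sum_apply, Pi.smul_apply, smul_eq_mul, Finset.mul_sum]
      rw [Finset.sum_comm]
      exact Finset.sum_congr rfl fun r _ => Finset.sum_congr rfl fun j _ => by ring
    rw [e, hg]
    simp
  have T0 := key (N 0 0)
  have T1 := key (N 1 1)
  have T2 := key (N 0 2)
  have T3 := key (N 1 2)
  have T4 := key (N 0 3)
  have T5 := key (N 1 3)
  have T6 := key (N 2 3)
  have T7 := key (N 0 1)
  have T8 := key (N 1 0)
  have T9 := key v₀'
  have T10 := key v₀
  simp [Fin.sum_univ_succ, Matrix.cons_val_zero, Matrix.cons_val_succ, hNMf, hNv0, hNv0',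
    hv0M, hv0'M, hv0v0, hv0'v0', hv0'v0] at T0 T1 T2 T3 T4 T5 T6 T7 T8 T9 T10
  have g0 : g 0 = 0 := by
    rcases T0 with h | h | h
    exacts [h, absurd h hρ, absurd h hlam]
  have g1 : g 1 = 0 := by
    rcases T1 with h | h | h
    exacts [h, absurd h hρ, absurd h hlam]
  have g9 : g 9 = 0 := T9.resolve_right hlam
  have g10 : g 10 = 0 := T10.resolve_right hlam
  have hρ' : ρ * ∑ r, c r * v₀ r * v₀' r ≠ 0 := mul_ne_zero hρ hlam
  have e23 : g 2 = g 3 := by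
    have h : (g 3 - g 2) * (ρ * ∑ r, c r * v₀ r * v₀' r) = 0 := by
      linear_combination T7 - T8
    exact (sub_eq_zero.1 ((mul_eq_zero.1 h).resolve_right hρ')).symm
  have g2 : g 2 = 0 := by
    rw [← e23] at T6
    have h : g 2 * ((2 : K)⁻¹ * 2) = 0 := by linear_combination T6
    simpa using h
  have g3 : g 3 = 0 := e23 ▸ g2
  have g4 : g 4 = 0 := by
    rw [g2] at T7
    simpa using T7
  intro i
  fin_cases i <;> assumption

/-- **The four relations** (memo §2c): with the eleven vectors spanning `K^κ`, every left-kernel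
combination `ν₂₀ − ν₀₂, ν₂₁ − ν₁₂, ν₃₁ − ν₁₃, ν₃₂ − ν₂₃` is orthogonal to all of them, hence zero.
[folklore] -/
theorem relations_of_span [CharZero K] {κ : Type v} [Fintype κ] [DecidableEq κ]
    (c : κ → K) (N M : Fin 4 → Fin 4 → κ → K) (v₀ v₀' : κ → K) (ρ : K)
    (hNMf : ∀ a b y z : Fin 4, ∑ r, c r * N b y r * M a z r =
      (if (a ≠ b ∧ a ≠ y ∧ a ≠ z ∧ b ≠ y ∧ b ≠ z ∧ y ≠ z) then (1 / 2 : K) else 0) -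
      ρ * ((Pi.single a 1 : Fin 4 → K) 0 * (Pi.single y 1 : Fin 4 → K) 1 +
        (Pi.single a 1 : Fin 4 → K) 1 * (Pi.single y 1 : Fin 4 → K) 0) *
      ((Pi.single b 1 : Fin 4 → K) 0 * (Pi.single z 1 : Fin 4 → K) 1 +
        (Pi.single b 1 : Fin 4 → K) 1 * (Pi.single z 1 : Fin 4 → K) 0) *
      ∑ r, c r * v₀ r * v₀' r)
    (hNv0 : ∀ b y : Fin 4, ∑ r, c r * N b y r * v₀ r = 0)
    (hNv0' : ∀ b y : Fin 4, ∑ r, c r * N b y r * v₀' r = 0)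

    (hc : ∀ r, c r ≠ 0)
    (hspan : Submodule.span K (Set.range (![M 1 1, M 0 0, M 0 1, M 1 0, M 2 3, M 1 3, M 0 3, M 1 2, M 0 2, v₀, v₀'] : Fin 11 → κ → K)) = ⊤) :
    (∀ r, N 2 0 r = N 0 2 r) ∧ (∀ r, N 2 1 r = N 1 2 r) ∧ (∀ r, N 3 1 r = N 1 3 r) ∧
      (∀ r, N 3 2 r = N 2 3 r) := by
  classical
  have wsub : ∀ x y w : κ → K, ∑ r, c r * (x - y) r * w r =
      ∑ r, c r * x r * w r - ∑ r, c r * y r * w r := fun x y w => by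
    rw [← Finset.sum_sub_distrib]; exact Finset.sum_congr rfl fun r _ => by rw [Pi.sub_apply]; ring
  have rel : ∀ b y : Fin 4, (∀ j, ∑ r, c r * (N b y - N y b) r *
      (![M 1 1, M 0 0, M 0 1, M 1 0, M 2 3, M 1 3, M 0 3, M 1 2, M 0 2, v₀, v₀'] : Fin 11 → κ → K) j r = 0) → ∀ r, N b y r = N y b r := by
    intro b y h r
    have hz := eq_zero_of_orth_span c hc _ hspan _ h
    have := congr_fun hz r
    rw [Pi.sub_apply, Pi.zero_apply, sub_eq_zero] at this
    exact this
  refine ⟨rel 2 0 fun j => ?_, rel 2 1 fun j => ?_, rel 3 1 fun j => ?_, rel 3 2 fun j => ?_⟩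
  all_goals
    fin_cases j <;> (rw [wsub]; simp [hNMf, hNv0, hNv0'])

/-- **The double-swap corner on the same pair is empty.**  See the module docstring. [folklore] -/
theorem false_of_double_swap_same_pair [CharZero K] {κ : Type v} [Fintype κ] [DecidableEq κ]
    (hκ : Fintype.card κ ≤ 11) (c : κ → K) (hc : ∀ r, c r ≠ 0)
    (t : κ → (((Fin 4 → K) × (Fin 4 → K)) →ₗ[K] ((Fin 4 → K) × (Fin 4 → K)) →ₗ[K] K))
    (hJ : ∀ a b y₂ y₃ : Fin 4 → K,
      ∑ r, c r * (t r (a, b) (y₂, y₃)) ^ 2 = (Matrix.of ![a, b, y₂, y₃]).permanent)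
    (v₀ v₀' : κ → K) (hv₀ : ∀ (a x : Fin 4 → K), ∃ s : K, (fun r => t r (a, 0) (x, 0)) = s • v₀)
    (hv₀' : ∀ (b x : Fin 4 → K), ∃ s : K, (fun r => t r (0, b) (0, x)) = s • v₀')
    (hpeel : ∃ a b y z : Fin 4 → K, ∑ r, c r * t r (a, 0) (y, 0) * t r (0, b) (0, z) ≠ 0)
    (u₀ u₁ : K) (hψ : ∀ (a x : Fin 4 → K) r, t r (a, 0) (x, 0) = u₀ * (a 0 * x 1 + a 1 * x 0) * v₀ r)
    (hψ' : ∀ (b x : Fin 4 → K) r, t r (0, b) (0, x) = u₁ * (b 0 * x 1 + b 1 * x 0) * v₀' r) :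
    False := by
  have hpeel0 := hpeel
  classical
  -- ===== Gram bookkeeping, verbatim after `…TwoPencilDesign.twelve_le_card_of_frame` =====
  have t00 : ∀ r (p : (Fin 4 → K) × (Fin 4 → K)), t r ((0 : Fin 4 → K), (0 : Fin 4 → K)) p = 0 :=
    fun r p => by rw [show ((0 : Fin 4 → K), (0 : Fin 4 → K)) = (0 : (Fin 4 → K) × (Fin 4 → K))
      from rfl, map_zero, LinearMap.zero_apply]
  have t00' : ∀ r (p : (Fin 4 → K) × (Fin 4 → K)), t r p ((0 : Fin 4 → K), (0 : Fin 4 → K)) = 0 :=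
    fun r p => by rw [show ((0 : Fin 4 → K), (0 : Fin 4 → K)) = (0 : (Fin 4 → K) × (Fin 4 → K))
      from rfl, map_zero]
  obtain ⟨a', b', yy, zz, hne⟩ := hpeel
  have hv0facts : (∑ r, c r * v₀ r ^ 2 = 0) ∧
      (∀ (a y : Fin 4 → K), ∑ r, c r * v₀ r * t r (a, 0) (0, y) = 0) ∧
      (∀ (b x : Fin 4 → K), ∑ r, c r * v₀ r * t r (0, b) (x, 0) = 0) := by
    rcases scalar_block_dichotomy c t hJ v₀ hv₀ with hz | h
    · exact absurd (Finset.sum_eq_zero fun r _ => by rw [hz a' yy r]; ring) hne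
    · exact h
  obtain ⟨hQv, hA₃, hB₂⟩ := hv0facts
  set tS : κ → (((Fin 4 → K) × (Fin 4 → K)) →ₗ[K] ((Fin 4 → K) × (Fin 4 → K)) →ₗ[K] K) :=
    fun r => ((t r).compl₁₂ (LinearEquiv.prodComm K (Fin 4 → K) (Fin 4 → K)).toLinearMap
      LinearMap.id).compl₂ (LinearEquiv.prodComm K (Fin 4 → K) (Fin 4 → K)).toLinearMap with htS
  have hJS : ∀ a b y₂ y₃ : Fin 4 → K,
      ∑ r, c r * (tS r (a, b) (y₂, y₃)) ^ 2 = (Matrix.of ![a, b, y₂, y₃]).permanent :=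
    hJ_yswap c _ (hJ_swap c t hJ)
  have htSap : ∀ r (a b y₂ y₃ : Fin 4 → K), tS r (a, b) (y₂, y₃) = t r (b, a) (y₃, y₂) :=
    fun r a b y₂ y₃ => by simp [htS]
  have hv0'facts : (∑ r, c r * v₀' r ^ 2 = 0) ∧
      (∀ (b y : Fin 4 → K), ∑ r, c r * v₀' r * t r (0, b) (y, 0) = 0) ∧
      (∀ (a x : Fin 4 → K), ∑ r, c r * v₀' r * t r (a, 0) (0, x) = 0) := by
    rcases scalar_block_dichotomy c tS hJS v₀' (fun b x => by
        obtain ⟨s, hs⟩ := hv₀' b x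
        exact ⟨s, by rw [← hs]; funext r; exact htSap r b 0 x 0⟩) with hz | ⟨h1, h2, h3⟩
    · refine absurd (Finset.sum_eq_zero fun r _ => ?_) hne
      have := hz b' zz r; rw [htSap] at this; rw [this]; ring
    · refine ⟨h1, fun b y => ?_, fun a x => ?_⟩
      · have := h2 b y; simpa only [htSap] using this
      · have := h3 a x; simpa only [htSap] using this
  obtain ⟨hQv', hB₂', hA₃'⟩ := hv0'facts
  have hlam : ∑ r, c r * v₀ r * v₀' r ≠ 0 := by
    obtain ⟨s, hs⟩ := hv₀ a' yy
    obtain ⟨s', hs'⟩ := hv₀' b' zz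
    have e1 : ∀ r, t r (a', 0) (yy, 0) = s * v₀ r := fun r => by
      have := congr_fun hs r; simpa using this
    have e2 : ∀ r, t r (0, b') (0, zz) = s' * v₀' r := fun r => by
      have := congr_fun hs' r; simpa using this
    intro h0
    apply hne
    have : ∑ r, c r * t r (a', 0) (yy, 0) * t r (0, b') (0, zz) =
        s * s' * ∑ r, c r * v₀ r * v₀' r := by
      rw [Finset.mul_sum]; exact Finset.sum_congr rfl fun r _ => by rw [e1, e2]; ring
    rw [this, h0, mul_zero]
  let ν : (Fin 4 → K) →ₗ[K] (Fin 4 → K) →ₗ[K] (κ → K) :=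
    LinearMap.mk₂ K (fun b y => fun r => t r (0, b) (y, 0))
      (fun b b' y => by
        funext r
        have : (((0 : Fin 4 → K), b + b') : (Fin 4 → K) × (Fin 4 → K)) = (0, b) + (0, b') := by simp
        simp only [Pi.add_apply, this, map_add, LinearMap.add_apply])
      (fun s b y => by
        funext r
        have : (((0 : Fin 4 → K), s • b) : (Fin 4 → K) × (Fin 4 → K)) = s • (0, b) := by simp
        simp only [Pi.smul_apply, this, map_smul, LinearMap.smul_apply, smul_eq_mul])
      (fun b y y' => by
        funext r
        have : ((y + y', (0 : Fin 4 → K)) : (Fin 4 → K) × (Fin 4 → K)) = (y, 0) + (y', 0) := by simp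
        simp only [Pi.add_apply, this, map_add])
      (fun s b y => by
        funext r
        have : ((s • y, (0 : Fin 4 → K)) : (Fin 4 → K) × (Fin 4 → K)) = s • (y, 0) := by simp
        simp only [Pi.smul_apply, this, map_smul, smul_eq_mul])
  have hνap : ∀ b y r, ν b y r = t r (0, b) (y, 0) := fun b y r => rfl
  let μ : (Fin 4 → K) →ₗ[K] (Fin 4 → K) →ₗ[K] (κ → K) :=
    LinearMap.mk₂ K (fun a z => fun r => t r (a, 0) (0, z))
      (fun a a' z => by
        funext r
        have : ((a + a', (0 : Fin 4 → K)) : (Fin 4 → K) × (Fin 4 → K)) = (a, 0) + (a', 0) := by simp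
        simp only [Pi.add_apply, this, map_add, LinearMap.add_apply])
      (fun s a z => by
        funext r
        have : ((s • a, (0 : Fin 4 → K)) : (Fin 4 → K) × (Fin 4 → K)) = s • (a, 0) := by simp
        simp only [Pi.smul_apply, this, map_smul, LinearMap.smul_apply, smul_eq_mul])
      (fun a z z' => by
        funext r
        have : (((0 : Fin 4 → K), z + z') : (Fin 4 → K) × (Fin 4 → K)) = (0, z) + (0, z') := by simp
        simp only [Pi.add_apply, this, map_add])
      (fun s a z => by
        funext r
        have : (((0 : Fin 4 → K), s • z) : (Fin 4 → K) × (Fin 4 → K)) = s • (0, z) := by simp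
        simp only [Pi.smul_apply, this, map_smul, smul_eq_mul])
  have hμap : ∀ a z r, μ a z r = t r (a, 0) (0, z) := fun a z r => rfl
  have hred := reduced_identity_of_scalar c t hJ v₀ v₀' hv₀ hv₀'
  have hνiso : ∀ b y, ∑ r, c r * ν b y r * ν b y r = 0 := by
    intro b y
    have h := hred 0 b y 0
    simp only [t00, t00', add_zero, mul_zero, Finset.sum_const_zero, sub_zero,
      per_zero_row₀] at h
    rw [← h]
    exact Finset.sum_congr rfl fun r _ => by rw [hνap]; ring
  have hμiso : ∀ a z, ∑ r, c r * μ a z r * μ a z r = 0 := by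
    intro a z
    have h := hred a 0 0 z
    simp only [t00, t00', zero_add, mul_zero, Finset.sum_const_zero, sub_zero,
      per_zero_row₂] at h
    rw [← h]
    exact Finset.sum_congr rfl fun r _ => by rw [hμap]; ring
  have hX : ∀ a b y z, 2 * ∑ r, c r * ν b y r * μ a z r =
      (Matrix.of ![a, b, y, z]).permanent - 2 * ∑ r, c r * t r (a, 0) (y, 0) * t r (0, b) (0, z) := by
    intro a b y z
    have h := hred a b y z
    have e : ∑ r, c r * (t r (0, b) (y, 0) + t r (a, 0) (0, z)) ^ 2 =
        ∑ r, c r * ν b y r * ν b y r + ∑ r, c r * μ a z r * μ a z r +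
          2 * ∑ r, c r * ν b y r * μ a z r := by
      rw [Finset.mul_sum, ← Finset.sum_add_distrib, ← Finset.sum_add_distrib]
      exact Finset.sum_congr rfl fun r _ => by rw [hνap, hμap]; ring
    rw [e, hνiso, hμiso, zero_add, zero_add] at h
    exact h
  have hνν_b : ∀ b b' y, ∑ r, c r * ν b y r * ν b' y r = 0 := fun b b' y =>
    wdot_eq_zero_of_isotropic c _ _ (hνiso b y) (hνiso b' y)
      (by rw [← LinearMap.add_apply, ← map_add]; exact hνiso (b + b') y)
  have hνν_y : ∀ b y y', ∑ r, c r * ν b y r * ν b y' r = 0 := fun b y y' =>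
    wdot_eq_zero_of_isotropic c _ _ (hνiso b y) (hνiso b y') (by rw [← map_add]; exact hνiso b (y + y'))
  have hν4 : ∀ b b' y y', ∑ r, c r * ν b y r * ν b' y' r + ∑ r, c r * ν b y' r * ν b' y r = 0 := by
    intro b b' y y'
    have h := hνiso (b + b') (y + y')
    have hX : ν (b + b') (y + y') = ν b y + ν b y' + ν b' y + ν b' y' := by
      simp only [map_add, LinearMap.add_apply]; abel
    rw [hX, wdot_four, hνiso, hνiso, hνiso, hνiso, hνν_y b y y', hνν_b b b' y, hνν_b b b' y',
      hνν_y b' y y'] at h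
    have h' : (2 : K) * (∑ r, c r * ν b y r * ν b' y' r + ∑ r, c r * ν b y' r * ν b' y r) = 0 := by
      linear_combination h
    exact (mul_eq_zero.1 h').resolve_left two_ne_zero
  -- ===== memo §2: spanning and the relations =====
  -- full cross pairings
  have hcorr : ∀ a b y z : Fin 4, ∑ r, c r * t r (Pi.single a 1, 0) (Pi.single y 1, 0) *
      t r (0, Pi.single b 1) (0, Pi.single z 1) =
      u₀ * ((Pi.single a 1 : Fin 4 → K) 0 * (Pi.single y 1 : Fin 4 → K) 1 +
        (Pi.single a 1 : Fin 4 → K) 1 * (Pi.single y 1 : Fin 4 → K) 0) *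
      (u₁ * ((Pi.single b 1 : Fin 4 → K) 0 * (Pi.single z 1 : Fin 4 → K) 1 +
        (Pi.single b 1 : Fin 4 → K) 1 * (Pi.single z 1 : Fin 4 → K) 0)) *
      ∑ r, c r * v₀ r * v₀' r := by
    intro a b y z
    rw [Finset.mul_sum]
    exact Finset.sum_congr rfl fun r _ => by rw [hψ, hψ']; ring
  have hNMf : ∀ a b y z : Fin 4,
      ∑ r, c r * ν (Pi.single b 1) (Pi.single y 1) r * μ (Pi.single a 1) (Pi.single z 1) r =
      (if (a ≠ b ∧ a ≠ y ∧ a ≠ z ∧ b ≠ y ∧ b ≠ z ∧ y ≠ z) then (1 / 2 : K) else 0) -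
      u₀ * ((Pi.single a 1 : Fin 4 → K) 0 * (Pi.single y 1 : Fin 4 → K) 1 +
        (Pi.single a 1 : Fin 4 → K) 1 * (Pi.single y 1 : Fin 4 → K) 0) *
      (u₁ * ((Pi.single b 1 : Fin 4 → K) 0 * (Pi.single z 1 : Fin 4 → K) 1 +
        (Pi.single b 1 : Fin 4 → K) 1 * (Pi.single z 1 : Fin 4 → K) 0)) *
      ∑ r, c r * v₀ r * v₀' r := by
    intro a b y z
    have h := hX (Pi.single a 1) (Pi.single b 1) (Pi.single y 1) (Pi.single z 1)
    rw [per_basis, hcorr] at h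
    split_ifs at h ⊢ <;> linear_combination h / 2
  -- u₀ ≠ 0, u₁ ≠ 0
  have hu₀ : u₀ ≠ 0 := by
    rintro rfl; apply hne
    exact Finset.sum_eq_zero fun r _ => by rw [hψ]; ring
  have hu₁ : u₁ ≠ 0 := by
    rintro rfl; apply hne
    exact Finset.sum_eq_zero fun r _ => by rw [hψ']; ring
  have hv0v0 : ∑ r, c r * v₀ r * v₀ r = 0 := by
    rw [← hQv]; exact Finset.sum_congr rfl fun r _ => by ring
  have hv0'v0' : ∑ r, c r * v₀' r * v₀' r = 0 := by
    rw [← hQv']; exact Finset.sum_congr rfl fun r _ => by ring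
  have hNMf' : ∀ a b y z : Fin 4,
      ∑ r, c r * (fun b y => ν (Pi.single b 1) (Pi.single y 1)) b y r *
        (fun a z => μ (Pi.single a 1) (Pi.single z 1)) a z r =
      (if (a ≠ b ∧ a ≠ y ∧ a ≠ z ∧ b ≠ y ∧ b ≠ z ∧ y ≠ z) then (1 / 2 : K) else 0) -
      (u₀ * u₁) * ((Pi.single a 1 : Fin 4 → K) 0 * (Pi.single y 1 : Fin 4 → K) 1 +
        (Pi.single a 1 : Fin 4 → K) 1 * (Pi.single y 1 : Fin 4 → K) 0) *
      ((Pi.single b 1 : Fin 4 → K) 0 * (Pi.single z 1 : Fin 4 → K) 1 +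
        (Pi.single b 1 : Fin 4 → K) 1 * (Pi.single z 1 : Fin 4 → K) 0) *
      ∑ r, c r * v₀ r * v₀' r := fun a b y z => by rw [hNMf]; ring
  have hli := linearIndependent_eleven c (fun b y => ν (Pi.single b 1) (Pi.single y 1))
    (fun a z => μ (Pi.single a 1) (Pi.single z 1)) v₀ v₀' (u₀ * u₁) hNMf'
    (fun b y => by rw [wdot_comm]; exact hB₂ _ _) (fun b y => by rw [wdot_comm]; exact hB₂' _ _)
    (fun a z => hA₃ _ _) (fun a z => hA₃' _ _) hv0v0 hv0'v0' (mul_ne_zero hu₀ hu₁) hlam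
  have hcardκ : Fintype.card κ = 11 := by
    refine le_antisymm hκ ?_
    have h := hli.fintype_card_le_finrank
    simpa using h
  have hspan := hli.span_eq_top_of_card_eq_finrank' (by simp [hcardκ])
  obtain ⟨R20, R21, R31, R32⟩ := relations_of_span c (fun b y => ν (Pi.single b 1) (Pi.single y 1))
    (fun a z => μ (Pi.single a 1) (Pi.single z 1)) v₀ v₀' (u₀ * u₁) hNMf'
    (fun b y => by rw [wdot_comm]; exact hB₂ _ _) (fun b y => by rw [wdot_comm]; exact hB₂' _ _)
    hc hspan
  exact false_of_swap_of_relations hκ c t hJ v₀ v₀' hv₀ hv₀' hpeel0 u₀ hψ R20 R21 R31 R32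

end Summit.ValiantsHypothesis.ValiantsHypothesis.Theorems.SymPencilPerFourPeeledCornerSwapSamePair

end
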